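import Literature.AlgebraicGeometry.Motives.HodgeStructurePontryaginInteriorProduct
import HarnessLib

/-!
# Pontryagin's isomorphism transposes the Lefschetz `𝔰𝔩₂`: `Φ(i(v̂) a) = Φ(a) ∘ e(v)` (Bourbaki, the mirror of `Φ(ℓ ∧ a) = Φ(a) ∘ i(ℓ)`),
# hence `Φ(Λ_{ω^∨} a) = Φ(a) ∘ L_ω` and `Φ(L_{ω^∨} a) = Φ(a) ∘ Λ_ω` — on homology `H_• = (⋀W)^∨ ≅ ⋀(W^∨)` the transposes of `L_ω`, `Λ_ω`
# are the DUAL Lefschetz operators `Λ_{ω^∨}`, `L_{ω^∨}` of the dual symplectic space `(W^∨, ω^∨ = Σᵢ eᵢ* ∧ fᵢ*)`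

[topic AlgebraicGeometry/Motives]

Layer `Literature/AlgebraicGeometry/Motives`, lane `lit-hodgefound` (Track 2 foundations library; prover seat `lit-hodgefound-p34`,
generation 36, row g36-#10). THEOREMS ONLY (no definition, no named fact, no instance, no notation; net debt `0`). Sequel of row g36-#7
(`HodgeStructurePontryaginInteriorProduct`: Laplace expansion `ann_ιMulti_succ`, `Φ(ℓ ∧ a) = Φ(a) ∘ i(ℓ)`, `Ψ ∘ Λ_ω = Φ(ω^∨) ⋆ Ψ`), of rows
g35-#5/g36-#3 (`Φ(ℓ_1 ∧ ⋯ ∧ ℓ_m)(v_1 ∧ ⋯ ∧ v_m) = det(ℓ_j(v_i))`, `Φ` multiplicative and bijective) and g29-#1 (`ann = i(·)` = Mathlib's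
`contractLeft`; `Λ = lam b = Σᵢ i(fᵢ*) i(eᵢ*)`, `L = ω ∧ ·`, `twoVector b = Σᵢ eᵢ ∧ fᵢ`).

THE POINT. `⋀W` and `⋀(W^∨)` are in perfect duality through `Φ` (Pontryagin = Bourbaki's determinant pairing), and under this duality
interior products and exterior multiplications are mutually transposed ON BOTH SIDES: row g36-#7 proved `Φ(ℓ ∧ a) = Φ(a) ∘ i(ℓ)` (`ℓ ∈ W^∨`);
here §1 proves the mirror statement `Φ(i(v̂) a) = Φ(a) ∘ e(v)` for `v ∈ W` acting on `⋀(W^∨)` through the evaluation `v̂ = Module.Dual.eval v ∈ W^∨∨`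
— the Laplace expansion of `det(ℓ_j(v_i))` along its first ROW (Mathlib `Matrix.det_succ_row_zero`) against the Laplace expansion of `i(v̂)`
(row g36-#7 `ann_ιMulti_succ` on `W^∨`). Summing over a Darboux basis (§2): the dual symplectic space `(W^∨, ω^∨)`, `ω^∨ = twoVector b.dualBasis`,
has `Λ_{ω^∨} = Σᵢ i(f̂ᵢ) i(êᵢ)` (its Darboux basis is `b.dualBasis`, whose coordinate forms are the evaluations `êᵢ, f̂ᵢ`), and
`Φ(Λ_{ω^∨} a) = Φ(a) ∘ L_ω`, `Φ(L_{ω^∨} a) = Φ(a) ∘ Λ_ω`: Pontryagin's isomorphism carries the Lefschetz `𝔰𝔩₂`-triple of `(W^∨, ω^∨)` to the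
TRANSPOSE of that of `(W, ω)` with `e ↔ f` exchanged — the homological Lefschetz structure of an abelian variety.

## Sources, VERBATIM

N. Bourbaki, *Algebra I, Chapters 1–3* [BourbakiAlgebraI1989], Ch. III §11 no. 9 (interior products `i(x)`, `x ∈ ⋀(M)` acting on `⋀(M*)` and
`x* ∈ ⋀(M*)` acting on `⋀(M)`, as transposes of left multiplication for the canonical pairing of no. 5), no. 5 (`⟨x₁* ∧ ⋯ ∧ x_p*, x₁ ∧ ⋯ ∧ x_p⟩ =
det(⟨x_i*, x_j⟩)`), §8 no. 6 (expansion of a determinant along a row). H. Lange, *Abelian Varieties over the Complex Numbers* (2023)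
[Lange2023AbelianVarietiesComplex], §2.5.3 Lemma 2.5.12 (p0133: `{λ_{i_1} ⋆ ⋯ ⋆ λ_{i_p}}` dual to `{dx_I}` — `H_• = ⋀H_1`), Lemma 2.5.14 (p0134:
Poincaré duality in these bases); C. Voisin [Voisin2002] §6.2.1 Lemma 6.19 (`Λ` in a symplectic basis).

## What is proved (all `theorem`s)

* §1 **`pontryaginMap_ann_eval`: `Φ(i(v̂) a) = Φ(a) ∘ e(v)`** (`e(v) = LinearMap.mulLeft K (ι v)`, `v̂ = Module.Dual.eval K W v`) for every
  `a ∈ ⋀(W^∨)`, through `pontryaginMap_ann_eval_ιMulti` (on `ℓ_0 ∧ ⋯ ∧ ℓ_n`: row expansion of `det(ℓ_j(v_i))`).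
* §2 `dualBasis_coord_eq_eval` (the coordinate forms of `b.dualBasis` are the evaluations `b̂ᵢ`), **`pontryaginMap_lefschetzDual_dual`:
  `Φ(Λ_{ω^∨} a) = Φ(a) ∘ L_ω`** (for `ω = twoVector b`, any Darboux basis `b`), **`IsSymplectic.pontryaginMap_twoVector_dual_mul`: `Φ(ω^∨ ∧ a) = Φ(a) ∘ Λ_ω`** (row g36-#7 §4 read on `Φ(a)`),
  i.e. `Φ ∘ L_{ω^∨} = (· ∘ Λ_ω) ∘ Φ` and `Φ ∘ Λ_{ω^∨} = (· ∘ L_ω) ∘ Φ`.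

TWIN NOTICE (RULING 29 bis): nothing of the torus-forms carriers or of `Motives/AbelianVarietyHopf` is imported or restated.

## References

* [BourbakiAlgebraI1989] N. Bourbaki, *Algebra I*, Ch. III §8 no. 6, §11 no. 5, no. 9.
* [Lange2023AbelianVarietiesComplex] H. Lange, *Abelian Varieties over the Complex Numbers* (2023), §2.5.3 Lemma 2.5.12, Lemma 2.5.14 (p0133–p0134).
* [Voisin2002] C. Voisin, *Hodge Theory and Complex Algebraic Geometry I* (2002), §6.2.1 Lemma 6.19.
-/

noncomputable section

open scoped TensorProduct

namespace Literature.AlgebraicGeometry.Motives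

namespace ExteriorLefschetz

open ExteriorAlgebra

variable {K : Type*} [Field K] {W : Type*} [AddCommGroup W] [Module K W]

/-! ## §1 `Φ(i(v̂) a) = Φ(a) ∘ e(v)` -/

/-- **`Φ(i(v̂)(ℓ_0 ∧ ⋯ ∧ ℓ_n)) = Φ(ℓ_0 ∧ ⋯ ∧ ℓ_n) ∘ e(v)`**: on `v_1 ∧ ⋯ ∧ v_n` the right-hand side is `det(ℓ_j((v, v_1, …, v_n)_i))`, whose
expansion along the first row `Σ_j (−1)^j ℓ_j(v) det(minor_j)` (Mathlib `Matrix.det_succ_row_zero`) is the left-hand side by the Laplace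
expansion `i(v̂)(ℓ_0 ∧ ⋯ ∧ ℓ_n) = Σ_j (−1)^j ℓ_j(v) ℓ_0 ∧ ⋯ ℓ̂_j ⋯ ∧ ℓ_n` (row g36-#7 on `W^∨`); off degree `n` both sides vanish.
[cite: BourbakiAlgebraI1989, Ch. III §11 no. 5, no. 9 and §8 no. 6] [cite: Lange2023AbelianVarietiesComplex, §2.5.3 Lemma 2.5.12 (p0133)] -/
theorem pontryaginMap_ann_eval_ιMulti (v : W) {n : ℕ} (ℓ : Fin (n + 1) → Module.Dual K W) :
    pontryaginMap K W (ann K (Module.Dual K W) (Module.Dual.eval K W v) (ιMulti K (n + 1) ℓ)) =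
      pontryaginMap K W (ιMulti K (n + 1) ℓ) ∘ₗ LinearMap.mulLeft K (ι K v) := by
  rw [ann_ιMulti_succ, map_sum, pontryaginMap_ιMulti]
  simp only [map_smul, pontryaginMap_ιMulti, Module.Dual.eval_apply]
  refine LinearMap.ext fun z ↦ ?_
  rw [LinearMap.comp_apply, LinearMap.mulLeft_apply, LinearMap.sum_apply]
  induction z using DirectSum.Decomposition.inductionOn (fun i : ℕ ↦ ⋀[K]^i W) with
  | zero => simp only [mul_zero, map_zero, Finset.sum_const_zero]
  | add z z' hz hz' =>
    rw [mul_add, map_add, ← hz, ← hz', ← Finset.sum_add_distrib]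
    exact Finset.sum_congr rfl fun j _ ↦ by rw [LinearMap.smul_apply, LinearMap.smul_apply, LinearMap.smul_apply, map_add, smul_add]
  | @homogeneous q z =>
    by_cases hq : q = n
    · subst hq
      -- both sides are linear on `⋀^q W`; compare them on `v_1 ∧ ⋯ ∧ v_q`
      have key : (∑ j : Fin (q + 1), ((-1 : K) ^ (j : ℕ) * ℓ j v) • dualConvProd K W q (ℓ ∘ j.succAbove)) ∘ₗ (⋀[K]^q W).subtype =
          (dualConvProd K W (q + 1) ℓ ∘ₗ LinearMap.mulLeft K (ι K v)) ∘ₗ (⋀[K]^q W).subtype := by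
        refine LinearMap.ext_on_range (exteriorPower.ιMulti_span K q W) fun w ↦ ?_
        have hvw : ι K v * ιMulti K q w = ιMulti K (q + 1) (Matrix.vecCons v w) := by
          rw [ιMulti_succ_apply, Matrix.cons_val_zero, Matrix.tail_cons]
        rw [LinearMap.comp_apply, LinearMap.comp_apply, Submodule.subtype_apply, exteriorPower.ιMulti_apply_coe, LinearMap.sum_apply,
          LinearMap.comp_apply, LinearMap.mulLeft_apply, hvw, dualConvProd_ιMulti, Matrix.det_succ_row_zero]
        refine Finset.sum_congr rfl fun j _ ↦ ?_
        rw [LinearMap.smul_apply, dualConvProd_ιMulti, smul_eq_mul, Matrix.of_apply, Matrix.cons_val_zero]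
        congr 2
      have hk := LinearMap.congr_fun key z
      rw [LinearMap.comp_apply, LinearMap.comp_apply, Submodule.subtype_apply, LinearMap.sum_apply, LinearMap.comp_apply,
        LinearMap.mulLeft_apply] at hk
      exact hk
    · have hvz : ι K v * (z : ExteriorAlgebra K W) ∈ ⋀[K]^(1 + q) W :=
        SetLike.mul_mem_graded (Literature.LinearAlgebra.Alternating.ι_mem_exteriorPower_one K v) z.2
      rw [dualConvProd_apply_eq_zero_of_mem (by omega : 1 + q ≠ n + 1) ℓ hvz, Finset.sum_eq_zero fun j _ ↦ ?_]
      rw [LinearMap.smul_apply, dualConvProd_apply_eq_zero_of_mem hq _ z.2, smul_zero]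

/-- **`Φ(i(v̂) a) = Φ(a) ∘ e(v)` FOR EVERY `a ∈ ⋀(W^∨)`** — the interior product by `v ∈ W` (as the evaluation `v̂ ∈ W^∨∨`) on `⋀(W^∨) = ⋀H_1`
is carried by Pontryagin's map to the transpose of left exterior multiplication `e(v) : z ↦ v ∧ z` on `H• = ⋀W` (the mirror of row g36-#7
`pontryaginMap_ι_mul : Φ(ℓ ∧ a) = Φ(a) ∘ i(ℓ)`). [cite: BourbakiAlgebraI1989, Ch. III §11 no. 9] -/
theorem pontryaginMap_ann_eval (v : W) (a : ExteriorAlgebra K (Module.Dual K W)) :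
    pontryaginMap K W (ann K (Module.Dual K W) (Module.Dual.eval K W v) a) = pontryaginMap K W a ∘ₗ LinearMap.mulLeft K (ι K v) := by
  suffices h : pontryaginMap K W ∘ₗ ann K (Module.Dual K W) (Module.Dual.eval K W v) =
      LinearMap.lcomp K K (LinearMap.mulLeft K (ι K v)) ∘ₗ pontryaginMap K W by
    have := LinearMap.congr_fun h a
    rwa [LinearMap.comp_apply, LinearMap.comp_apply, LinearMap.lcomp_apply'] at this
  refine ExteriorAlgebra.lhom_ext fun m ↦ AlternatingMap.ext fun ℓ ↦ ?_
  rw [LinearMap.compAlternatingMap_apply, LinearMap.compAlternatingMap_apply, LinearMap.comp_apply, LinearMap.comp_apply,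
    LinearMap.lcomp_apply']
  cases m with
  | zero =>
    rw [ιMulti_zero_apply, ann_apply_one, map_zero, pontryaginMap_one]
    refine LinearMap.ext fun z ↦ ?_
    rw [LinearMap.zero_apply, LinearMap.comp_apply, LinearMap.mulLeft_apply, AlgHom.toLinearMap_apply, map_mul, algebraMapInv_ι, zero_mul]
  | succ n => exact pontryaginMap_ann_eval_ιMulti v ℓ

/-! ## §2 `Φ(Λ_{ω^∨} a) = Φ(a) ∘ L_ω` and `Φ(L_{ω^∨} a) = Φ(a) ∘ Λ_ω` -/

/-- The coordinate forms of the dual basis are the evaluations: `(b^∨).coord i = b̂ᵢ = eval (b i)`. [cite: BourbakiAlgebraI1989, Ch. II §2 no. 7 (biduality)] -/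
theorem dualBasis_coord_eq_eval {ι : Type*} [Fintype ι] [DecidableEq ι] (b : Module.Basis ι K W) (i : ι) :
    b.dualBasis.coord i = Module.Dual.eval K W (b i) := by
  refine LinearMap.ext fun ℓ ↦ ?_
  rw [Module.Basis.coord_apply, Module.Basis.dualBasis_repr, Module.Dual.eval_apply]

/-- **`Φ(i(φ̂) i(ψ̂) a) = Φ(a) ∘ e(ψ) e(φ) = Φ(a) ∘ e(ψ ∧ φ)`** (§1 twice). [cite: BourbakiAlgebraI1989, Ch. III §11 no. 9] -/
theorem pontryaginMap_ann_eval_ann_eval (v w : W) (a : ExteriorAlgebra K (Module.Dual K W)) :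
    pontryaginMap K W (ann K (Module.Dual K W) (Module.Dual.eval K W v) (ann K (Module.Dual K W) (Module.Dual.eval K W w) a)) =
      pontryaginMap K W a ∘ₗ LinearMap.mulLeft K (ι K w * ι K v) := by
  rw [pontryaginMap_ann_eval, pontryaginMap_ann_eval, LinearMap.mulLeft_mul, LinearMap.comp_assoc]

variable [CharZero K] in
/-- **`Φ(Λ_{ω^∨} a) = Φ(a) ∘ L_ω`: PONTRYAGIN'S ISOMORPHISM CARRIES THE DUAL LEFSCHETZ OPERATOR OF THE DUAL SYMPLECTIC SPACE `(W^∨, ω^∨)` TO THE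
TRANSPOSE OF `L_ω = ω ∧ ·`** — `ω = Σᵢ eᵢ ∧ fᵢ` in the Darboux basis `b`, `ω^∨ = twoVector b.dualBasis = Σᵢ eᵢ* ∧ fᵢ*` (symplectic of genus `g` on
`W^∨` with Darboux basis `b.dualBasis`, coordinate forms `êᵢ, f̂ᵢ`), `Λ_{ω^∨} = Σᵢ i(f̂ᵢ) i(êᵢ)` (row g29-#1 `lefschetzDual_eq_lam`), and §1:
`Φ(i(f̂ᵢ) i(êᵢ) a) = Φ(a) ∘ e(eᵢ ∧ fᵢ)`. (With row g36-#7 `Ψ ∘ Λ_ω = Φ(ω^∨) ⋆ Ψ`, i.e. `Φ(ω^∨ ∧ a) = Φ(a) ∘ Λ_ω`: `Φ` intertwines the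
Lefschetz triple of `(W^∨, ω^∨)` with the transposed triple of `(W, ω)`, `e` and `f` exchanged.) [cite: Voisin2002, §6.2.1 Lemma 6.19]
[cite: BourbakiAlgebraI1989, Ch. III §11 no. 9] [cite: Lange2023AbelianVarietiesComplex, §2.5.3 Lemma 2.5.12 and Lemma 2.5.14 (p0133–p0134)] -/
theorem pontryaginMap_lefschetzDual_dual {g : ℕ} (b : Module.Basis (Fin g ⊕ Fin g) K W) (a : ExteriorAlgebra K (Module.Dual K W)) :
    pontryaginMap K W (lefschetzDual (twoVector b.dualBasis) g a) = pontryaginMap K W a ∘ₗ LinearMap.mulLeft K (twoVector b) := by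
  classical
  rw [(isSymplectic_twoVector b.dualBasis).lefschetzDual_eq_lam b.dualBasis rfl, lam, LinearMap.sum_apply, map_sum, twoVector]
  refine LinearMap.ext fun z ↦ ?_
  rw [LinearMap.sum_apply, LinearMap.comp_apply, LinearMap.mulLeft_apply, Finset.sum_mul, map_sum]
  refine Finset.sum_congr rfl fun i _ ↦ ?_
  rw [Module.End.mul_apply, dualBasis_coord_eq_eval, dualBasis_coord_eq_eval, pontryaginMap_ann_eval_ann_eval,
    LinearMap.comp_apply, LinearMap.mulLeft_apply]

variable [CharZero K] in
/-- **`Φ(ω^∨ ∧ a) = Φ(a) ∘ Λ_ω`**: the mirror statement (row g36-#7 §4 `Ψ ∘ Λ_ω = Φ(ω^∨) ⋆ Ψ` at `Ψ = Φ(a)`, `Φ` multiplicative) — `Φ` carries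
`L_{ω^∨}` to the transpose of `Λ_ω`. [cite: Voisin2002, §6.2.1 Lemma 6.19] [cite: BourbakiAlgebraI1989, Ch. III §11 no. 9] -/
theorem IsSymplectic.pontryaginMap_twoVector_dual_mul {g : ℕ} {ω : ExteriorAlgebra K W} (hω : IsSymplectic ω g)
    (b : Module.Basis (Fin g ⊕ Fin g) K W) (hb : ω = twoVector b) (a : ExteriorAlgebra K (Module.Dual K W)) :
    pontryaginMap K W (twoVector b.dualBasis * a) = pontryaginMap K W a ∘ₗ lefschetzDual ω g := by
  rw [pontryaginMap_mul, hω.comp_lefschetzDual_eq_dualConv b hb]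

end ExteriorLefschetz

end Literature.AlgebraicGeometry.Motives
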